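import Literature.Computability.AlgebraicComplexity.MatMulM22RankLowerBound
import HarnessLib

/-!
# Nazarov's lower bound for the bilinear complexity of matrix multiplication over a finite field

Topic `Literature/Computability/AlgebraicComplexity` (bilinear complexity; small formats over finite fields). ONE
named fact (the published theorem, not proved here) and PROVED numerical corollaries.

* **Nazarov 2023, Theorem** (Vestn. Mosk. Univ. Ser. 15 Vychisl. Mat. Kibern. 2023 no. 4, 41–53, p. 42, restated as
  eq. (7) in §4; English translation Mosc. Univ. Comput. Math. Cybern. 47 (4) (2023) 218–231), verbatim structure:
  "Билинейная сложность умножения матрицы размера `n × s` на матрицу размера `s × m` над конечным полем с `K`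
  элементами, `s ⩾ n ⩾ 2`, не меньше, чем `(n + s − 1)(1 + 1/(f(K,n,s) − 1)) m`", where
  `f(K,n,s) = (K^s − 1)²/(K^s − 2K + 1)` if `s = n ≥ 3`, `(K^{s−1} − 1)(K^s − 1)/(K^{s−1} − K^{s−n})` if
  `s > n ≥ 3`, `K^s + 3` if `s = n = 2`, `K^s + 1` if `s > n = 2`. The case `s = n = 2` is Alekseev–Nazarov 2019
  (the paper's Remark); by Hopcroft–Musinski duality the bound holds for every permutation of `(n, s, m)`.
* Corollaries proved here from the fact: over a field with `3` elements, `17 ≤ R(⟨2,2,5⟩)` (`f = 12`, bound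
  `180/11`) and `14 ≤ R(⟨2,2,4⟩)` (bound `144/11`) — the same integers as Alekseev's any-field `3m + 2`
  (`MatMulM22RankLowerBound.lean`); in particular the cell `17 ≤ R_𝔽₃(⟨2,2,5⟩) ≤ 18` is NOT closed by this theorem.

## References

* A. A. Nazarov, *O nizhnei otsenke bilineinoi slozhnosti umnozheniya matrits nad konechnym polem*, Vestn. Mosk.
  Univ. Ser. 15 (2023) no. 4, 41–53 (transl. Mosc. Univ. Comput. Math. Cybern. 47 (4) (2023) 218–231), Theorem
  p. 42 / eq. (7). [Nazarov2023FiniteFieldLB]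
* V. B. Alekseev, A. A. Nazarov, Mosc. Univ. Comput. Math. Cybern. 43 (2019) 149–155 (the case `s = n = 2`).
-/

namespace Literature.Computability.AlgebraicComplexity

/-- Nazarov's auxiliary function `f(K, n, s)` (as printed, `ℚ`-valued; the four cases of the theorem, `s ≥ n ≥ 2`).
[cite: Nazarov2023FiniteFieldLB, Theorem (p. 42) / eq. (7)] -/
noncomputable def nazarov2023F (K n s : ℕ) : ℚ :=
  if s = n ∧ 3 ≤ n then ((K : ℚ) ^ s - 1) ^ 2 / ((K : ℚ) ^ s - 2 * K + 1)
  else if n < s ∧ 3 ≤ n then (((K : ℚ) ^ (s - 1) - 1) * ((K : ℚ) ^ s - 1)) / ((K : ℚ) ^ (s - 1) - (K : ℚ) ^ (s - n))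
  else if s = n then (K : ℚ) ^ s + 3
  else (K : ℚ) ^ s + 1

/-- **Nazarov 2023, Theorem** (named fact, not proved here): over a finite field with `K` elements, for
`s ≥ n ≥ 2` and every `m`, the bilinear complexity of `n × s` by `s × m` matrix multiplication is at least
`(n + s − 1) · (1 + 1/(f(K,n,s) − 1)) · m`.
[cite: Nazarov2023FiniteFieldLB, Theorem (p. 42 of the Russian original) / eq. (7) §4] -/
def nazarov2023_rank_matMulTensor_ge : Prop :=
  ∀ (F : Type) [Field F] [Fintype F] (n s m : ℕ), 2 ≤ n → n ≤ s →
    ((n + s - 1 : ℕ) : ℚ) * (1 + 1 / (nazarov2023F (Fintype.card F) n s - 1)) * m ≤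
      (tensorRank (matMulTensor F n s m) : ℚ)

/-- Corollary at `K = 3`, format `⟨2,2,5⟩`: `f = 12`, bound `3 · (12/11) · 5 = 180/11`, hence
`17 ≤ R_𝔽₃(⟨2,2,5⟩)` (the same integer as Alekseev 2014/2015 over any field).
[cite: Nazarov2023FiniteFieldLB, Theorem (p. 42) / eq. (7) §4, case s = n = 2] -/
theorem nazarov2023_seventeen_le_tensorRank_matMulTensor_225 (h : nazarov2023_rank_matMulTensor_ge)
    (F : Type) [Field F] [Fintype F] (hF : Fintype.card F = 3) :
    17 ≤ tensorRank (matMulTensor F 2 2 5) := by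
  have h1 := h F 2 2 5 le_rfl le_rfl
  rw [hF] at h1
  have hf : nazarov2023F 3 2 2 = 12 := by norm_num [nazarov2023F]
  rw [hf] at h1
  norm_num at h1
  have h2 : (16 : ℚ) < tensorRank (matMulTensor F 2 2 5) := by linarith
  exact_mod_cast h2

/-- Corollary at `K = 3`, format `⟨2,2,4⟩`: bound `3 · (12/11) · 4 = 144/11`, hence `14 ≤ R_𝔽₃(⟨2,2,4⟩)`.
[cite: Nazarov2023FiniteFieldLB, Theorem (p. 42) / eq. (7) §4, case s = n = 2] -/
theorem nazarov2023_fourteen_le_tensorRank_matMulTensor_224 (h : nazarov2023_rank_matMulTensor_ge)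
    (F : Type) [Field F] [Fintype F] (hF : Fintype.card F = 3) :
    14 ≤ tensorRank (matMulTensor F 2 2 4) := by
  have h1 := h F 2 2 4 le_rfl le_rfl
  rw [hF] at h1
  have hf : nazarov2023F 3 2 2 = 12 := by norm_num [nazarov2023F]
  rw [hf] at h1
  norm_num at h1
  have h2 : (13 : ℚ) < tensorRank (matMulTensor F 2 2 4) := by linarith
  exact_mod_cast h2

end Literature.Computability.AlgebraicComplexity
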